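import Summits.Ventures.QEC.CircuitDistance.ETowerValueX
import Summits.Ventures.QEC.CircuitDistance.ETowerValueZ
import Summits.Ventures.QEC.CircuitDistance.PortBB144Value
import HarnessLib

/-!
# ★ `d_circ([[144,12,12]], print's depth-7 SM circuit) = 10` — CERTIFIED (KERNEL, std) (cell `qec`, experiment CDX,
# seat qec-cdx-type-1; R152 (2)(b) STEP 2 / R157 T-106 std amendment)

The K2 list-completeness binders `K2_BB144_X`, `K2_BB144_Z` are PROVED by the E-fold tower (`ETowerValueX.k2X`,
`ETowerValueZ.k2Z`: plain `decide +kernel` data facts + the audited soundness chain `kc_of_tower` / `binder_of_kc`), so the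
conditional word of record `bb144_circuitDistance_eq_ten (hX) (hZ)` (PortBB144Value, T-104) becomes unconditional with
STANDARD axioms only — no `native_decide` anywhere in the import closure.  (Statements written dedup-distinct from the
computational `PortBB144ValueComp.bb144_circuitDistance_eq_ten_holds`, which stays as the COMPUTATIONAL record.)
-/

namespace Summit.Ventures.QEC.CircuitDistance

open Literature.InformationTheory.QuantumCodes K2 Summit.Ventures.QEC.CircuitDistance.ETower

/-- ★ Both K2 list-completeness binders of the [[144,12,12]] port hold (E-fold tower, std axioms). -/
theorem bb144_K2_binders : K2_BB144_X ∧ K2_BB144_Z := ⟨SecX.k2X, SecZ.k2Z⟩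

/-- ★★★ **`d_circ([[144,12,12]]) = 10`, CERTIFIED (KERNEL, std)**: for every number of syndrome cycles `Nc ≥ 1`, the circuit
distance of print's depth-7 syndrome-measurement circuit of the `[[144,12,12]]` gross code, as written, is `10`. -/
theorem bb144_circuitDistance_eq_ten_std : ∀ Nc ≥ 1, circuitDistance bb144SM Nc = 10 :=
  fun Nc hNc => bb144_circuitDistance_eq_ten SecX.k2X SecZ.k2Z Nc hNc

/-- The claims-register row and CDX-Q2, std axioms: `BB144_circuitDistance_eq_ten_claim ∧ ¬ CDX_Q2`. -/
theorem bb144_claims_std : BB144_circuitDistance_eq_ten_claim ∧ ¬ CDX_Q2 :=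
  ⟨bb144_claim SecX.k2X SecZ.k2Z, bb144_not_CDX_Q2 SecX.k2X SecZ.k2Z⟩

end Summit.Ventures.QEC.CircuitDistance
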